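import Mathlib
import Literature.NumberTheory.Transcendental.GammaFields
import Literature.NumberTheory.Transcendental.GammaKummerLevels

/-!
# Case II core, file 4: exponential monomials over a level of the tower — coordinates and linear
independence
(helper file for the registered stub `stub_caseII_core` of line `eac-extends-core-automorphisms`,
crux stmt-Schanuel-0968 `Summit.Schanuel.Schanuel.Theses.RigidCore.AclSubsetLogFreeCore`)

Setting (one level of the canonical tower, abstracted): a subfield `k ≤ E` of an exponential field,
`ℚ`-subspaces `Y' ≤ Y''` with `exp Y' ⊆ k` and the transversality `exp y ∈ k → y ∈ Y'` on `Y''`,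
a tuple `b` of `Y''` which is a basis modulo `Y'`, and the standing hypothesis that for every
`N ≥ 1` the "level-`N` coordinates" `tᵢ = exp (bᵢ / N)` are algebraically independent over `k`.

* `exists_coords` — every `y ∈ Y''` is `y' + Σ (nᵢ / N) • bᵢ` with `y' ∈ Y'`, `nᵢ ∈ ℤ`, for any
  common denominator `N` of its coordinates; `exp y = exp y' * ∏ tᵢ ^ nᵢ`.
* **`linearIndependent_exp`** — exponentials of finitely many elements of `Y''` which are pairwise
  inequivalent modulo `Y'` are linearly independent over `k` (distinct Laurent monomials in
  algebraically independent coordinates).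
* `eq_of_sum_exp_eq_sum_exp` — MATCHING: two `k`-combinations of pairwise inequivalent exponential
  monomials with non-zero coefficients which are equal use the same classes modulo `Y'`, term by term.
-/

noncomputable section

set_option linter.dupNamespace false

open Set
open scoped BigOperators
open Literature.ModelTheory.ExponentialFields Literature.ModelTheory.ExponentialFields.ExponentialRing
open Literature.NumberTheory.Transcendental Literature.NumberTheory.Transcendental.GammaField

namespace Summit.Schanuel.Schanuel.Theorems.RigidCore

namespace CaseIICore

variable {E : Type*} [Field E] [CharZero E] [ExponentialRing E]

/-! ### Coordinates modulo `Y'` -/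

omit [ExponentialRing E] in
/-- **Integral coordinates with a common denominator.** If `b` spans `Y''` modulo `Y'`, every
`y ∈ Y''` is `y' + Σᵢ (nᵢ / N) • bᵢ` with `y' ∈ Y'`, `nᵢ ∈ ℤ` and some `N ≥ 1`. [folklore] -/
theorem exists_coords {Y' Y'' : Submodule ℚ E} {p : ℕ} (b : Fin p → E)
    (hbspan : ∀ y ∈ Y'', ∃ r : Fin p → ℚ, y - ∑ i, r i • b i ∈ Y') {y : E} (hy : y ∈ Y'') :
    ∃ (N : ℕ), 0 < N ∧ ∃ (n : Fin p → ℤ) (y' : E), y' ∈ Y' ∧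
      y = y' + ∑ i, ((n i : ℚ) / N) • b i := by
  classical
  obtain ⟨r, hr⟩ := hbspan y hy
  -- common denominator of the `r i`
  refine ⟨∏ i, (r i).den, Finset.prod_pos fun i _ => (r i).den_pos, fun i => (r i * ∏ j, ((r j).den : ℚ)).num,
    y - ∑ i, r i • b i, hr, ?_⟩
  have hint : ∀ i, ((r i * ∏ j, ((r j).den : ℚ)).num : ℚ) = r i * ∏ j, ((r j).den : ℚ) := by
    intro i
    have hdvd : ((r i).den : ℤ) ∣ ∏ j, ((r j).den : ℤ) := Finset.dvd_prod_of_mem _ (Finset.mem_univ i)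
    obtain ⟨m, hm⟩ := hdvd
    have h1 : r i * ∏ j, ((r j).den : ℚ) = ((r i).num * m : ℤ) := by
      have h2 : (∏ j, ((r j).den : ℚ)) = ((∏ j, ((r j).den : ℤ) : ℤ) : ℚ) := by push_cast; rfl
      rw [h2, hm]
      push_cast
      rw [← mul_assoc, Rat.mul_den_eq_num]
    rw [h1, Rat.num_intCast]
  have hN0 : ((∏ i, (r i).den : ℕ) : ℚ) ≠ 0 := by
    exact_mod_cast (Finset.prod_pos fun i _ => (r i).den_pos).ne'
  have hcoef : ∀ i, ((r i * ∏ j, ((r j).den : ℚ)).num : ℚ) / ((∏ i, (r i).den : ℕ) : ℚ) = r i := by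
    intro i
    rw [hint, Nat.cast_prod, mul_div_assoc, div_self (by exact_mod_cast hN0), mul_one]
  simp_rw [hcoef]
  abel

/-- The exponential of `y' + Σ (nᵢ / N) • bᵢ` in the level-`N` coordinates `tᵢ = exp (bᵢ / N)`.
[folklore] -/
theorem exp_coords {p : ℕ} (b : Fin p → E) (N : ℕ) (n : Fin p → ℤ) (y' : E) :
    exp (y' + ∑ i, ((n i : ℚ) / N) • b i) =
      exp y' * ∏ i, exp ((1 / (N : ℚ)) • b i) ^ (n i) := by
  rw [exp_add, exp_finset_sum]
  congr 1
  refine Finset.prod_congr rfl fun i _ => ?_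
  rw [← exp_zsmul, ← Int.cast_smul_eq_zsmul ℚ, smul_smul, div_eq_mul_one_div]

omit [ExponentialRing E] in
/-- **Integral coordinates with a common denominator, for a finite family.** [folklore] -/
theorem exists_coords_family {Y' Y'' : Submodule ℚ E} {p : ℕ} (b : Fin p → E)
    (hbspan : ∀ y ∈ Y'', ∃ r : Fin p → ℚ, y - ∑ i, r i • b i ∈ Y')
    {ι : Type*} [Fintype ι] (y : ι → E) (hy : ∀ j, y j ∈ Y'') :
    ∃ (N : ℕ), 0 < N ∧ ∃ (n : ι → Fin p → ℤ) (y' : ι → E), (∀ j, y' j ∈ Y') ∧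
      ∀ j, y j = y' j + ∑ i, ((n j i : ℚ) / N) • b i := by
  classical
  choose r hr using fun j => hbspan (y j) (hy j)
  -- common denominator of all `r j i`
  set N : ℕ := ∏ j, ∏ i, (r j i).den with hNdef
  have hNpos : 0 < N := Finset.prod_pos fun j _ => Finset.prod_pos fun i _ => (r j i).den_pos
  have hN0 : (N : ℚ) ≠ 0 := by exact_mod_cast hNpos.ne'
  refine ⟨N, hNpos, fun j i => (r j i * N).num, fun j => y j - ∑ i, r j i • b i, hr, fun j => ?_⟩
  have hint : ∀ i, (((r j i * N).num : ℤ) : ℚ) = r j i * N := by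
    intro i
    have hdvd : ((r j i).den : ℤ) ∣ (N : ℤ) := by
      rw [hNdef]; push_cast
      exact (Finset.dvd_prod_of_mem (fun i => ((r j i).den : ℤ)) (Finset.mem_univ i)).trans
        (Finset.dvd_prod_of_mem (fun j => ∏ i, ((r j i).den : ℤ)) (Finset.mem_univ j))
    obtain ⟨m, hm⟩ := hdvd
    have h1 : r j i * N = ((r j i).num * m : ℤ) := by
      rw [show (N : ℚ) = ((N : ℤ) : ℚ) by push_cast; rfl, hm]
      push_cast
      rw [← mul_assoc, Rat.mul_den_eq_num]
    rw [h1, Rat.num_intCast]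
  have hcoef : ∀ i, (((r j i * N).num : ℤ) : ℚ) / N = r j i := fun i => by
    rw [hint, mul_div_assoc, div_self hN0, mul_one]
  simp_rw [hcoef]
  abel

omit [ExponentialRing E] in
/-- Equal integral coordinates iff equivalent modulo `Y'` (for `b` independent modulo `Y'`).
[folklore] -/
theorem coords_eq_iff {Y' : Submodule ℚ E} {p : ℕ} (b : Fin p → E)
    (hblin : ∀ r : Fin p → ℚ, (∑ i, r i • b i) ∈ Y' → r = 0)
    {N : ℕ} (hN : 0 < N) {n n' : Fin p → ℤ} {y' y'' : E} (hy' : y' ∈ Y') (hy'' : y'' ∈ Y') :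
    (y' + ∑ i, ((n i : ℚ) / N) • b i) - (y'' + ∑ i, ((n' i : ℚ) / N) • b i) ∈ Y' ↔ n = n' := by
  have hdiff : (y' + ∑ i, ((n i : ℚ) / N) • b i) - (y'' + ∑ i, ((n' i : ℚ) / N) • b i) =
      (y' - y'') + ∑ i, (((n i : ℚ) - n' i) / N) • b i := by
    simp only [sub_div, sub_smul, Finset.sum_sub_distrib]
    abel
  rw [hdiff]
  constructor
  · intro h
    have hsum : (∑ i, (((n i : ℚ) - n' i) / N) • b i) ∈ Y' := by
      have := Y'.sub_mem h (Y'.sub_mem hy' hy'')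
      rwa [add_sub_cancel_left] at this
    have h0 := hblin _ hsum
    funext i
    have hi := congrFun h0 i
    simp only [Pi.zero_apply, div_eq_zero_iff, Nat.cast_eq_zero] at hi
    rcases hi with hi | hi
    · exact_mod_cast sub_eq_zero.1 hi
    · exact absurd hi hN.ne'
  · rintro rfl
    simp only [sub_self, zero_div, zero_smul, Finset.sum_const_zero, add_zero]
    exact Y'.sub_mem hy' hy''

/-! ### Linear independence of exponential monomials over `k` -/

open Classical in
/-- **Aggregated coefficients of exponential sums vanish.**  Let `y : ι → Y''` be a finite family and
`c : ι → k` coefficients with `Σ c j * exp (y j) = 0`.  Then for every `j₀`, the aggregated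
coefficient of the class of `y j₀` modulo `Y'` vanishes:
`Σ_{j : y j - y j₀ ∈ Y'} c j * exp (y j - y j₀) = 0`.  (In the level-`N` coordinates the sum is a
Laurent polynomial in the algebraically independent `tᵢ = exp (bᵢ / N)` over `k`, classes modulo `Y'`
being the exponent vectors.) [folklore] -/
theorem sum_class_eq_zero (k : Subfield E) {Y' Y'' : Submodule ℚ E} {p : ℕ} (b : Fin p → E)
    (hbspan : ∀ y ∈ Y'', ∃ r : Fin p → ℚ, y - ∑ i, r i • b i ∈ Y')
    (hblin : ∀ r : Fin p → ℚ, (∑ i, r i • b i) ∈ Y' → r = 0)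
    (hexpY' : ∀ y ∈ Y', exp y ∈ k)
    (hAI : ∀ N : ℕ, 0 < N → AlgebraicIndependent k (fun i => exp ((1 / (N : ℚ)) • b i)))
    {ι : Type*} [Fintype ι] (y : ι → E) (hy : ∀ j, y j ∈ Y'')
    (c : ι → E) (hc : ∀ j, c j ∈ k) (hsum : ∑ j, c j * exp (y j) = 0) (j₀ : ι) :
    ∑ j ∈ Finset.univ.filter (fun j => y j - y j₀ ∈ Y'), c j * exp (y j - y j₀) = 0 := by
  obtain ⟨N, hN, n, y', hy', hyeq⟩ := exists_coords_family b hbspan y hy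
  set t : Fin p → E := fun i => exp ((1 / (N : ℚ)) • b i) with ht
  have ht0 : ∀ i, t i ≠ 0 := fun i => exp_ne_zero _
  -- shift exponents to be non-negative: `e j i = n j i + s i` with `s i = Σ_j |n j i|`
  set sh : Fin p → ℤ := fun i => ∑ j, |n j i| with hsh
  have hle : ∀ j i, 0 ≤ n j i + sh i := fun j i => by
    have h1 : |n j i| ≤ sh i := by
      rw [hsh]; exact Finset.single_le_sum (fun j' _ => abs_nonneg (n j' i)) (Finset.mem_univ j)
    have h2 := neg_abs_le (n j i)
    omega
  set e : ι → Fin p →₀ ℕ := fun j => Finsupp.equivFunOnFinite.symm fun i => (n j i + sh i).toNat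
    with he
  have he_apply : ∀ j i, ((e j i : ℕ) : ℤ) = n j i + sh i := fun j i => by
    simp only [he, Finsupp.coe_equivFunOnFinite_symm, Int.toNat_of_nonneg (hle j i)]
  -- `exp (y j) = κ j * w * ∏ t ^ e j` with `w = ∏ t ^ (-sh)`
  set κ : ι → E := fun j => exp (y' j) with hκ
  have hκk : ∀ j, κ j ∈ k := fun j => hexpY' _ (hy' j)
  have hκ0 : ∀ j, κ j ≠ 0 := fun j => exp_ne_zero _
  set w : E := ∏ i, t i ^ (-(sh i)) with hw
  have hw0 : w ≠ 0 := Finset.prod_ne_zero_iff.2 fun i _ => zpow_ne_zero _ (ht0 i)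
  have hexpj : ∀ j, exp (y j) = κ j * w * ∏ i, t i ^ (e j i : ℕ) := by
    intro j
    rw [hyeq j, exp_coords b N (n j) (y' j), mul_assoc, hw, ← Finset.prod_mul_distrib]
    congr 1
    refine Finset.prod_congr rfl fun i _ => ?_
    rw [← zpow_natCast, ← zpow_add₀ (ht0 i), he_apply,
      show -sh i + (n j i + sh i) = n j i by ring]
  -- the polynomial `P = Σ_j (c j κ j) X^(e j)` over `k` evaluates to `0`
  set d : ι → k := fun j => ⟨c j * κ j, mul_mem (hc j) (hκk j)⟩ with hd
  set P : MvPolynomial (Fin p) k := ∑ j, MvPolynomial.monomial (e j) (d j) with hP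
  have haeval : MvPolynomial.aeval t P = 0 := by
    have h1 : ∀ j, MvPolynomial.aeval t (MvPolynomial.monomial (e j) (d j)) =
        c j * κ j * ∏ i, t i ^ (e j i : ℕ) := by
      intro j
      rw [MvPolynomial.aeval_monomial, show (algebraMap k E) (d j) = c j * κ j from rfl,
        Finsupp.prod_fintype _ _ (fun i => pow_zero _)]
    have h2 : w * MvPolynomial.aeval t P = ∑ j, c j * exp (y j) := by
      rw [hP, map_sum, Finset.mul_sum]
      refine Finset.sum_congr rfl fun j _ => ?_
      rw [h1, hexpj j]; ring
    rw [hsum] at h2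
    exact (mul_eq_zero.1 h2).resolve_left hw0
  have hP0 : P = 0 := (hAI N hN) (by rw [haeval, map_zero])
  -- coefficient of `X^(e j₀)`
  have hcoeff : ∑ j ∈ Finset.univ.filter (fun j => e j = e j₀), d j = 0 := by
    have h1 := congrArg (MvPolynomial.coeff (e j₀)) hP0
    rw [hP, MvPolynomial.coeff_sum, MvPolynomial.coeff_zero] at h1
    simp only [MvPolynomial.coeff_monomial] at h1
    rw [← h1, Finset.sum_filter]
  -- classes modulo `Y'` are exponent vectors
  have hclass : ∀ j, y j - y j₀ ∈ Y' ↔ e j = e j₀ := by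
    intro j
    rw [hyeq j, hyeq j₀, coords_eq_iff b hblin hN (hy' j) (hy' j₀)]
    constructor
    · intro h; ext i
      have := he_apply j i; rw [h] at this; rw [← he_apply j₀ i] at this; exact_mod_cast this
    · intro h; funext i
      have h1 := he_apply j i; have h2 := he_apply j₀ i
      rw [h] at h1; omega
  have hfilter : Finset.univ.filter (fun j => y j - y j₀ ∈ Y') = Finset.univ.filter (fun j => e j = e j₀) :=
    Finset.filter_congr fun j _ => hclass j
  -- conclusion: divide by `κ j₀`
  have hterm : ∀ j ∈ Finset.univ.filter (fun j => y j - y j₀ ∈ Y'),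
      c j * exp (y j - y j₀) = (d j : E) * (κ j₀)⁻¹ := by
    intro j hj
    have hjY : y j - y j₀ ∈ Y' := (Finset.mem_filter.1 hj).2
    have hnn : n j = n j₀ := by
      have := (hclass j).1 hjY
      funext i
      have h1 := he_apply j i; have h2 := he_apply j₀ i
      rw [this] at h1; omega
    have hdiff : y j - y j₀ = y' j - y' j₀ := by
      rw [hyeq j, hyeq j₀, hnn]; abel
    rw [hdiff, show (d j : E) = c j * κ j from rfl, sub_eq_add_neg, exp_add, exp_neg_eq_inv,
      mul_assoc]
  rw [Finset.sum_congr rfl hterm, ← Finset.sum_mul, hfilter]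
  have h0 : (∑ j ∈ Finset.univ.filter (fun j => e j = e j₀), (d j : E)) = 0 := by
    rw [← AddSubmonoidClass.coe_finsetSum, hcoeff]; rfl
  rw [h0, zero_mul]

open Classical in
/-- **Exponentials of pairwise inequivalent elements are linearly independent over `k`.**
[folklore] -/
theorem eq_zero_of_sum_exp_eq_zero (k : Subfield E) {Y' Y'' : Submodule ℚ E} {p : ℕ} (b : Fin p → E)
    (hbspan : ∀ y ∈ Y'', ∃ r : Fin p → ℚ, y - ∑ i, r i • b i ∈ Y')
    (hblin : ∀ r : Fin p → ℚ, (∑ i, r i • b i) ∈ Y' → r = 0)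
    (hexpY' : ∀ y ∈ Y', exp y ∈ k)
    (hAI : ∀ N : ℕ, 0 < N → AlgebraicIndependent k (fun i => exp ((1 / (N : ℚ)) • b i)))
    {ι : Type*} [Fintype ι] (y : ι → E) (hy : ∀ j, y j ∈ Y'')
    (hineq : ∀ j j', j ≠ j' → y j - y j' ∉ Y')
    (c : ι → E) (hc : ∀ j, c j ∈ k) (hsum : ∑ j, c j * exp (y j) = 0) (j₀ : ι) : c j₀ = 0 := by
  have h := sum_class_eq_zero k b hbspan hblin hexpY' hAI y hy c hc hsum j₀
  have hfilter : Finset.univ.filter (fun j => y j - y j₀ ∈ Y') = {j₀} := by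
    ext j
    simp only [Finset.mem_filter, Finset.mem_univ, true_and, Finset.mem_singleton]
    constructor
    · intro hj; by_contra hne; exact hineq j j₀ hne hj
    · rintro rfl; rw [sub_self]; exact Y'.zero_mem
  rw [hfilter, Finset.sum_singleton, sub_self, exp_zero, mul_one] at h
  exact h

open Classical in
/-- **Matching of two exponential sums.** If `Σ c j * exp (y j) = Σ d j' * exp (z j')` for two
finite families in `Y''`, each pairwise inequivalent modulo `Y'`, with non-zero coefficients in `k`,
then every term on the left equals a term on the right with an equivalent exponent. [folklore] -/
theorem exists_match_of_sum_exp_eq (k : Subfield E) {Y' Y'' : Submodule ℚ E} {p : ℕ} (b : Fin p → E)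
    (hbspan : ∀ y ∈ Y'', ∃ r : Fin p → ℚ, y - ∑ i, r i • b i ∈ Y')
    (hblin : ∀ r : Fin p → ℚ, (∑ i, r i • b i) ∈ Y' → r = 0)
    (hexpY' : ∀ y ∈ Y', exp y ∈ k)
    (hAI : ∀ N : ℕ, 0 < N → AlgebraicIndependent k (fun i => exp ((1 / (N : ℚ)) • b i)))
    {ι ι' : Type*} [Fintype ι] [Fintype ι']
    (y : ι → E) (hy : ∀ j, y j ∈ Y'') (hineqy : ∀ j₁ j₂, j₁ ≠ j₂ → y j₁ - y j₂ ∉ Y')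
    (c : ι → E) (hc : ∀ j, c j ∈ k) (hc0 : ∀ j, c j ≠ 0)
    (z : ι' → E) (hz : ∀ j, z j ∈ Y'') (hineqz : ∀ j₁ j₂, j₁ ≠ j₂ → z j₁ - z j₂ ∉ Y')
    (d : ι' → E) (hd : ∀ j, d j ∈ k)
    (heq : ∑ j, c j * exp (y j) = ∑ j, d j * exp (z j)) (j : ι) :
    ∃ j' : ι', z j' - y j ∈ Y' ∧ c j * exp (y j) = d j' * exp (z j') := by
  -- the combined family on `ι ⊕ ι'` sums to zero
  set Yf : ι ⊕ ι' → E := Sum.elim y z with hYf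
  set Cf : ι ⊕ ι' → E := Sum.elim c (fun j' => -d j') with hCf
  have hYf : ∀ x, Yf x ∈ Y'' := by rintro (x | x) <;> simp [Yf, hy, hz]
  have hCf : ∀ x, Cf x ∈ k := by
    rintro (x | x)
    · exact hc x
    · exact neg_mem (hd x)
  have hsum : ∑ x, Cf x * exp (Yf x) = 0 := by
    rw [Fintype.sum_sum_type]
    simp only [Yf, Cf, Sum.elim_inl, Sum.elim_inr, neg_mul, Finset.sum_neg_distrib, heq,
      add_neg_cancel]
  have hagg := sum_class_eq_zero k b hbspan hblin hexpY' hAI Yf hYf Cf hCf hsum (Sum.inl j)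
  rw [Finset.sum_filter, Fintype.sum_sum_type] at hagg
  simp only [Yf, Cf, Sum.elim_inl, Sum.elim_inr] at hagg
  -- the `ι`-part is the single term `c j`
  have hι : (∑ i : ι, if y i - y j ∈ Y' then c i * exp (y i - y j) else 0) = c j := by
    rw [Finset.sum_eq_single j]
    · rw [if_pos (by rw [sub_self]; exact Y'.zero_mem), sub_self, exp_zero, mul_one]
    · intro i _ hij
      rw [if_neg (hineqy i j hij)]
    · intro h; exact absurd (Finset.mem_univ j) h
  rw [hι] at hagg
  -- some `j'` is equivalent to `y j`, and it is unique
  by_cases hex : ∃ j' : ι', z j' - y j ∈ Y'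
  · obtain ⟨j', hj'⟩ := hex
    refine ⟨j', hj', ?_⟩
    have hι' : (∑ i : ι', if z i - y j ∈ Y' then -d i * exp (z i - y j) else 0) =
        -d j' * exp (z j' - y j) := by
      rw [Finset.sum_eq_single j']
      · rw [if_pos hj']
      · intro i _ hij
        rw [if_neg]
        intro hi
        apply hineqz i j' hij
        have := Y'.sub_mem hi hj'
        rwa [sub_sub_sub_cancel_right] at this
      · intro h; exact absurd (Finset.mem_univ j') h
    rw [hι'] at hagg
    have h1 : c j = d j' * exp (z j' - y j) := by
      rw [neg_mul, ← sub_eq_add_neg, sub_eq_zero] at hagg; exact hagg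
    rw [h1, mul_assoc, ← exp_add, sub_add_cancel]
  · push Not at hex
    have hι' : (∑ i : ι', if z i - y j ∈ Y' then -d i * exp (z i - y j) else 0) = 0 :=
      Finset.sum_eq_zero fun i _ => by rw [if_neg (hex i)]
    rw [hι', add_zero] at hagg
    exact absurd hagg (hc0 j)

end CaseIICore

/-! ### Registered helper (crux stub list of stmt-Schanuel-0968) -/

/-- **Registered form of `CaseIICore.exists_match_of_sum_exp_eq`** (all binders explicit): matching
of two exponential sums with exponents pairwise inequivalent modulo `Y'`. [folklore] -/
theorem caseII_exists_match_of_sum_exp_eq {E : Type*} [Field E] [CharZero E] [ExponentialRing E]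
    (k : Subfield E) {Y' Y'' : Submodule ℚ E} {p : ℕ} (b : Fin p → E)
    (hbspan : ∀ y ∈ Y'', ∃ r : Fin p → ℚ, y - ∑ i, r i • b i ∈ Y')
    (hblin : ∀ r : Fin p → ℚ, (∑ i, r i • b i) ∈ Y' → r = 0)
    (hexpY' : ∀ y ∈ Y', exp y ∈ k)
    (hAI : ∀ N : ℕ, 0 < N → AlgebraicIndependent k (fun i => exp ((1 / (N : ℚ)) • b i)))
    {ι ι' : Type*} [Fintype ι] [Fintype ι']
    (y : ι → E) (hy : ∀ j, y j ∈ Y'') (hineqy : ∀ j₁ j₂, j₁ ≠ j₂ → y j₁ - y j₂ ∉ Y')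
    (c : ι → E) (hc : ∀ j, c j ∈ k) (hc0 : ∀ j, c j ≠ 0)
    (z : ι' → E) (hz : ∀ j, z j ∈ Y'') (hineqz : ∀ j₁ j₂, j₁ ≠ j₂ → z j₁ - z j₂ ∉ Y')
    (d : ι' → E) (hd : ∀ j, d j ∈ k)
    (heq : ∑ j, c j * exp (y j) = ∑ j, d j * exp (z j)) (j : ι) :
    ∃ j' : ι', z j' - y j ∈ Y' ∧ c j * exp (y j) = d j' * exp (z j') :=
  CaseIICore.exists_match_of_sum_exp_eq k b hbspan hblin hexpY' hAI y hy hineqy c hc hc0 z hz hineqz d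
    hd heq j

end Summit.Schanuel.Schanuel.Theorems.RigidCore
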